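import Mathlib
import HarnessLib
import Summits.HubbardSuperconductivity.HubbardSuperconductivity.Theorems.KLProgrammeKLRegimeEnginePairTransferOutClassForward
import Summits.HubbardSuperconductivity.HubbardSuperconductivity.Theorems.KLProgrammeKLRegimeEnginePairTransferMemberBornSigned

/-!
# Route `KLProgramme` — ENGINE item stmt-HubbardSuperconductivity-20437 `KLRegimeEngineV17F2`, stub (c) value lane, «(c)-OUT»: THE BORN LINE `RS` SIGNED, IN SLOTS —
# zero-transfer main term `ZS₀·Λₙ₊₁/2` by name + a QUARTER thermal share + lattice + flatness; the main term books into `eremBar`'s cubic slot; and the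
# universal zero-transfer FLOOR of `klEngGeo11.phGain` (cell gate-hubbard-kl, seat hubbard-kl-k3c2-p2 g18; recipe HOME/hubbard-kl-k3c2-p2/OUT-OF-CLASS-E2.md §6)

The capstone `outClass_sameFrame_le_slots` (…OutClassSameFrame) keeps the born row of the rows door as the binder `RS` (term `(Λₙ−Λₙ₊₁)·((βL²)³)⁻¹·2RS`);
…OutClassBornRegimes books it FLAT (`≤ 2·M6M2·1024·15367`).  Here the SIGNED born row of this lineage (`klms_memberBorn_signed_le`, …MemberBornSigned:
the zero-transfer forward bubble with the kernel product `V6·Σ` split into its frequency-pinned part — lattice data `(A₀, L_A)` — and a flat remainder `ε`) is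
read in the slots of (E2″-F)ₙ₊₁ exactly as the forward-window member lines were (…OutClassForwardQuarter), with the transfer slot vanishing (`|p_0|_𝕋 = 0`):
* `born_row_arith_quarter` — the booking arithmetic at transfer `0`: `3/(2π)·(Z·Λ₁ + T·th + R·(|0|+0)/Λ₁) + Lt/L ≤ Z·Λ₁/2 + CF·K·q/4 + Lt/L` (any `R`) for `T ≤ 2⁷⁷K`, `th ≤ 4q`, `CF ≥ 2⁸⁰`;
* **`born_member_row_signed_le_quarter`** — `(Λₙ−Λₙ₊₁)((βL²)³)⁻¹·‖S_S‖ ≤ ZS₀·Λₙ₊₁/2 + thermalBar klEngGeo11 P U β (n+1)/4 + LAT₀/L + ε·(2048·15367)` for every `n ≤ n_β`,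
  modulo the born kernel data `(A₀, L_A, ε)` of `V6·Σ` and ONE size `TH₀ ≤ 2⁷⁷(Klam U)²` (so the door's `2RS` costs `½·thermalBar` — with the member lines' `¼ + ¼` the step's ONE
  `thermalBar` exactly); `ZS₀`, `TH₀`, `LAT₀` are the literal constants of `klmsRowBound_reading` on the born data;
* `born_main_le_CR_slot` — the main term books into the cubic slot of `eremBar … n`: `ZS₀·klE0 ≤ 4s·Q.CR·(Klam|U|)³ ⇒ ZS₀·Λₙ₊₁ ≤ s·(Q.CR·(Klam|U|)³·(2ⁿ)⁻¹)`;
* `two_pow_28_min_le_klEngGeo11_phGain` — the universal ZERO-TRANSFER FLOOR `2²⁸·min 1 (2²⁴·(4ᵐ)⁻¹) ≤ klEngGeo11.phGain m ρ` at EVERY `m` and EVERY `ρ ≥ 0`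
  (below-resolution branch at `ρ = 0`; two-shell branch `≥ 2²⁴√klE0·2⁻ᵐ ≥ 2²⁴4⁻ᵐ` for `m ≥ 3`; `= 2²⁸` for `m ≤ 12`) — the alternative home of a zero-transfer term under any `phGain` slot.
Composition + arithmetic only; nothing about the model's sizes is asserted; nothing asserts (E2″-F), (c), K3 or superconductivity.  0 kit · 0 lit.
-/

noncomputable section

namespace Summit.HubbardSuperconductivity.HubbardSuperconductivity.Theorems.KLRegimeSplit

set_option linter.dupNamespace false -- summit = problem name (single-conjunct summit), D-0017

open Real Set Finset Complex Matrix Literature.MathematicalPhysics.QuantumLattice GrassmannAlgebra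
open Literature.Probability.LatticeModels hiding torusSupNorm
open Literature.MathematicalPhysics.QuantumLattice.BandSectorCounting
open Summit.HubbardSuperconductivity.HubbardSuperconductivity.Theorems.KLProgrammeLegKernels
open Summit.HubbardSuperconductivity.HubbardSuperconductivity.Theorems.KLRegimeWick
open Summit.HubbardSuperconductivity.HubbardSuperconductivity.Theorems.TwoPointAssembly
open Summit.HubbardSuperconductivity.HubbardSuperconductivity.Theorems.EngineV8
open Summit.HubbardSuperconductivity.HubbardSuperconductivity.Theorems.DispersionFlow
open Summit.HubbardSuperconductivity.HubbardSuperconductivity.Theorems.PerturbedFermiCurve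

/-! ## §1 Booking arithmetic at transfer `0` -/

/-- **Booking arithmetic for the born line, quarter thermal share**: `T ≤ 2⁷⁷K`, `th ≤ 4q`, `CF ≥ 2⁸⁰` ⇒
`3/(2π)·(Z·Λ₁ + T·th + R·((|0|+0)/Λ₁)) + Lt/LL ≤ Z·Λ₁/2 + CF·K·q/4 + Lt/LL`. -/
theorem born_row_arith_quarter {Z T R Lt LL Λ₁ th q K CF : ℝ} (hΛ : 0 < Λ₁) (hK : 0 ≤ K) (hZ0 : 0 ≤ Z) (hT0 : 0 ≤ T) (hT : T ≤ 2 ^ 77 * K)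
    (hth0 : 0 ≤ th) (hq0 : 0 ≤ q) (hth : th ≤ 4 * q) (hCF : 2 ^ 80 ≤ CF) :
    3 / (2 * π) * (Z * Λ₁ + T * th + R * ((|(0 : ℝ)| + 0) / Λ₁)) + Lt / LL ≤ Z * Λ₁ / 2 + CF * K * q / 4 + Lt / LL := by
  have hπ := Real.pi_pos
  have h3π : 3 / (2 * π) ≤ 1 / 2 := by rw [div_le_div_iff₀ (by positivity) (by norm_num)]; linarith [Real.pi_gt_three]
  have h3π0 : 0 ≤ 3 / (2 * π) := by positivity
  rw [abs_zero, zero_add, zero_div, mul_zero, add_zero]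
  have hTt : T * th ≤ CF * K * q / 2 := by
    have h1 : T * th ≤ T * (4 * q) := mul_le_mul_of_nonneg_left hth hT0
    have h2 : T * (4 * q) ≤ 2 ^ 77 * K * (4 * q) := mul_le_mul_of_nonneg_right hT (by positivity)
    have h3 : 2 ^ 80 * (K * q) ≤ CF * (K * q) := mul_le_mul_of_nonneg_right hCF (mul_nonneg hK hq0)
    linarith
  have hsum0 : 0 ≤ Z * Λ₁ + T * th := by positivity
  have h := mul_le_mul_of_nonneg_right h3π hsum0
  have hΛ' := hΛ.le
  linarith

/-! ## §2 The born line in slots -/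

section Model

variable {L M : ℕ} [NeZero L] [NeZero M] {β μ : ℝ} {K : TrigPolyC4v} {a' b' : ℝ} (B : BandBounds a' b') {R : RenConsts} {U : ℝ} {N : ℕ} {A : ℝ}

set_option maxHeartbeats 800000 in -- literal binders of the signed born row + three slot rewrites; plumbing only
/-- **THE BORN LINE `RS`, SIGNED, IN SLOTS** (module docstring): `(Λₙ−Λₙ₊₁)((βL²)³)⁻¹·‖S_S‖ ≤ ZS₀·Λₙ₊₁/2 + thermalBar/4 + LAT₀/L + ε·(2048·15367)`. -/
theorem born_member_row_signed_le_quarter (hR : ∀ j, 0 ≤ R.Gfr j) (hK : FrameOK R U N μ K)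
    (hAb : ∀ p : Momentum, ∀ j ≤ 2, ‖iteratedFDeriv ℝ j (frameShift K) p‖ ≤ A) (hA : 4 * A < B.Dtmin) (hA20 : 4 * A ≤ 1 / 20) (hμ : μ ≤ -0.15)
    (n : ℕ) {t : ℝ} (ht : t ∈ Icc (0 : ℝ) 1) (hβ : klBetaMin ≤ β) (hn : n + 1 ≤ nScales β + 1)
    (hM : β * (4 * klScale klE0 (n + 1)) / (2 * Real.pi) + 1 ≤ M)
    (Φ : ℕ → ℝ → FreqMomentum L M → ℝ) (hΦ : Φ = fun j t k => (softSymbolCompl L M β μ K (n + 1) j) k + (hubbardCutoffWeightCT L M β μ K (klScale klE0 (n + 1)) k -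
            hubbardCutoffWeightCT L M β μ K (klScale klE0 n + t * (klScale klE0 (n + 1) - klScale klE0 n)) k))
    (Wd : ℝ → FreqMomentum L M → ℝ) (hWd : Wd = fun t k => deriv (fun Λ' : ℝ => hubbardCutoffWeightCT L M β μ K Λ' k) (klScale klE0 n + t * (klScale klE0 (n + 1) - klScale klE0 n)))
    (V6 : ℕ → ℝ → (Fin 6 → HubbardFieldIdx L M) → ℂ) (Sg : ℕ → ℝ → FreqMomentum L M → Fin 2 → ℂ) {j : ℕ} (hj : n + 1 ≤ j) (Qm x y : TorusSite 2 L)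
    (hlo : a' < μ - 4 * klScale klE0 (n + 1) - 4 * A) (hhi : μ + 4 * klScale klE0 (n + 1) + 4 * A < b')
    {A₀ LA ε : ℝ} (hA0 : 0 ≤ A₀) (hLA : 0 ≤ LA) (hε : 0 ≤ ε)
    (hY0 : ∀ k : TorusSite 2 L, ‖∑ σ : Fin 2, V6 j t ![(((omega0 M, k), σ), 0), (((omega0 M, k), σ), 1), (((omega0 M, y), 0), 0), ((((omega0 M).rev, Qm - y), 1), 0),
        ((((omega0 M).rev, Qm - x), 1), 1), (((omega0 M, x), 0), 1)] * Sg j t (omega0 M, k) σ‖ ≤ A₀)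
    (hY1 : ∀ k k' : TorusSite 2 L, ‖(∑ σ : Fin 2, V6 j t ![(((omega0 M, k), σ), 0), (((omega0 M, k), σ), 1), (((omega0 M, y), 0), 0), ((((omega0 M).rev, Qm - y), 1), 0),
          ((((omega0 M).rev, Qm - x), 1), 1), (((omega0 M, x), 0), 1)] * Sg j t (omega0 M, k) σ) -
        ∑ σ : Fin 2, V6 j t ![(((omega0 M, k'), σ), 0), (((omega0 M, k'), σ), 1), (((omega0 M, y), 0), 0), ((((omega0 M).rev, Qm - y), 1), 0),
          ((((omega0 M).rev, Qm - x), 1), 1), (((omega0 M, x), 0), 1)] * Sg j t (omega0 M, k') σ‖ ≤ LA * klTorusNorm L (k - k'))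
    (hflat : ∀ (i : MatsubaraIdx M) (σ : Fin 2) (k : TorusSite 2 L), matsubaraFreq β M i ^ 2 ≤ (4 * klScale klE0 (n + 1)) ^ 2 →
      ‖V6 j t ![(((i, k), σ), 0), (((i, k), σ), 1), (((omega0 M, y), 0), 0), ((((omega0 M).rev, Qm - y), 1), 0), ((((omega0 M).rev, Qm - x), 1), 1),
              (((omega0 M, x), 0), 1)] * Sg j t (i, k) σ -
          V6 j t ![(((omega0 M, k), σ), 0), (((omega0 M, k), σ), 1), (((omega0 M, y), 0), 0), ((((omega0 M).rev, Qm - y), 1), 0), ((((omega0 M).rev, Qm - x), 1), 1),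
              (((omega0 M, x), 0), 1)] * Sg j t (omega0 M, k) σ‖ ≤ ε)
    (hβL : β ≤ L) (P : SplitConsts)
    (hTH : (393216 / Real.pi * (64 * (klScale klE0 (n + 1) / klScale klE0 j) ^ 2 + (2 * (448 / 3 * Real.exp 2) + 8) + 64) * (2 * A₀ * (Real.pi * Real.sqrt 2 / (B.Dtmin - 4 * A)))) ≤ 2 ^ 77 * (P.Klam * U) ^ 2) :
    (klScale klE0 n - klScale klE0 (n + 1)) * ((β * (L : ℝ) ^ 2) ^ 3)⁻¹ *
      ‖∑ p : FreqMomentum L M, ∑ σ : Fin 2,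
        (((((Wd t p) : ℝ) : ℂ) * (((β * (L : ℝ) ^ 2 : ℝ) : ℂ) * propCT L M β μ K p)) * ((((Φ j t p) : ℝ) : ℂ) * (((β * (L : ℝ) ^ 2 : ℝ) : ℂ) * propCT L M β μ K p))) *
          (V6 j t ![((p, σ), 0), ((p, σ), 1), (((omega0 M, y), 0), 0), ((((omega0 M).rev, Qm - y), 1), 0), ((((omega0 M).rev, Qm - x), 1), 1),
              (((omega0 M, x), 0), 1)] * Sg j t p σ)‖ ≤
      (524288 / Real.pi * (64 * (klScale klE0 (n + 1) / klScale klE0 j) ^ 2 + (2 * (448 / 3 * Real.exp 2) + 8) + 64) * (Real.pi * Real.sqrt 2 / (B.Dtmin - 4 * A) * (2 * LA + 2 * A₀ * (2 / (1 / 10))) / (B.Dtmin - 4 * A) + 2 * A₀ * (1 / (B.Dtmin - 4 * A) ^ 2 + Real.pi * Real.sqrt 2 * (2 + 4 * A) / (B.Dtmin - 4 * A) ^ 3))) * klScale klE0 (n + 1) / 2 + thermalBar klEngGeo11 P U β (n + 1) / 4 + (96 * (512 * LA / klScale klE0 (n + 1) + 32 * A₀ * (4 + 8 / 3 * R.Gfr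 1 * U ^ 2) * ((9 * (2 * (448 / 3 * Real.exp 2) + 8) + 4 * 8) + (65 * (8 * (16 : ℝ) ^ (j - (n + 1))) + 17408 / 3 * 1)) / klScale klE0 (n + 1) ^ 2)) / L + ε * (2048 * 15367) := by
  have hβ0 : 0 < β := lt_of_lt_of_le (by norm_num [klBetaMin]) hβ
  have hL : (0 : ℝ) < L := by exact_mod_cast Nat.pos_of_ne_zero (NeZero.ne L)
  have hβL2 : 0 < β * (L : ℝ) ^ 2 := by positivity
  have hΛ1 : 0 < klScale klE0 (n + 1) := klth_klScale_pos (n + 1)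
  have hΛj : 0 < klScale klE0 j := klth_klScale_pos j
  have hGfr : 0 ≤ R.Gfr 1 := hR 1
  have h83 : 0 ≤ 8 / 3 * R.Gfr 1 * U ^ 2 := by positivity
  have hG0 : 0 ≤ (4 + 8 / 3 * R.Gfr 1 * U ^ 2) := by linarith only [h83]
  have hA0' : 0 ≤ A := (norm_nonneg _).trans (hAb 0 0 (by norm_num))
  have hdA : 0 < B.Dtmin - 4 * A := by linarith only [hA]
  set dA : ℝ := B.Dtmin - 4 * A with hdAdef
  have hKl : 0 ≤ (P.Klam * U) ^ 2 := sq_nonneg _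
  have ha0 : 0 ≤ klScale klE0 n - klScale klE0 (n + 1) := by linarith only [(klmf_klScale_succ_pos_le n).2]
  have hc0 : 0 ≤ ((β * (L : ℝ) ^ 2) ^ 3)⁻¹ := by positivity
  -- (1) the signed born row
  have hsig := klms_memberBorn_signed_le β μ K B hR hK hAb hA hA20 hμ n ht hβ hn hM Φ hΦ Wd hWd V6 Sg hj Qm x y hlo hhi hA0 hLA hε hY0 hY1 hflat
  rw [klTorusNorm_zero, mul_zero] at hsig
  -- (2) the flat remainder and the running member's soft mass
  have hfl := klmsRoom_flat_le (L := L) (M := M) hβ0 μ K n ht (Φ j t) (C := 256 / 3) hε (by norm_num) (by norm_num)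
  have hsm : klSoftMass L M β μ K n (Φ j t) ≤ 15367 := by
    subst hΦ; exact klSoftMass_runningMember_le β μ K hK hβ hβL n hj ht
  -- (3) the exact reading of the row and the thermal dictionary
  have hread := klmsRowBound_reading B.Dtmin A (4 + 8 / 3 * R.Gfr 1 * U ^ 2) A₀ LA β n j 0 L
  have hnβ : n ≤ nScales β := by omega
  have hth := klmsRoom_thermal_le hβ hnβ
  have hq4 : ((4 : ℝ) ^ (nScales β - n))⁻¹ ≤ ((4 : ℝ) ^ (nScales β - (n + 1)))⁻¹ :=
    inv_anti₀ (by positivity) (pow_le_pow_right₀ (by norm_num) (by omega))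
  have hth' : Real.pi / β / klScale klE0 (n + 1) ≤ 4 * ((4 : ℝ) ^ (nScales β - (n + 1)))⁻¹ := hth.trans (by linarith only [hq4])
  have hth0 : 0 ≤ Real.pi / β / klScale klE0 (n + 1) := by positivity
  have harith := born_row_arith_quarter (LL := (L : ℝ)) (Lt := (96 * (512 * LA / klScale klE0 (n + 1) + 32 * A₀ * (4 + 8 / 3 * R.Gfr 1 * U ^ 2) * ((9 * (2 * (448 / 3 * Real.exp 2) + 8) + 4 * 8) + (65 * (8 * (16 : ℝ) ^ (j - (n + 1))) + 17408 / 3 * 1)) / klScale klE0 (n + 1) ^ 2)))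
    (Z := (524288 / Real.pi * (64 * (klScale klE0 (n + 1) / klScale klE0 j) ^ 2 + (2 * (448 / 3 * Real.exp 2) + 8) + 64) * (Real.pi * Real.sqrt 2 / (B.Dtmin - 4 * A) * (2 * LA + 2 * A₀ * (2 / (1 / 10))) / (B.Dtmin - 4 * A) + 2 * A₀ * (1 / (B.Dtmin - 4 * A) ^ 2 + Real.pi * Real.sqrt 2 * (2 + 4 * A) / (B.Dtmin - 4 * A) ^ 3))))
    (R := (256 / Real.pi * 8 * (2 * A₀ * (Real.pi * Real.sqrt 2 / (B.Dtmin - 4 * A))) * (65 * (8 * (16 : ℝ) ^ (j - (n + 1))) + 17408 / 3 * 1)))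
    hΛ1 hKl (by positivity) (by positivity) hTH hth0 (by positivity) hth' two_pow_eighty_le_klEngGeo11_CF
  have hTB : klEngGeo11.CF * (P.Klam * U) ^ 2 * ((4 : ℝ) ^ (nScales β - (n + 1)))⁻¹ = thermalBar klEngGeo11 P U β (n + 1) := rfl
  -- (4) abbreviate and assemble
  set a : ℝ := klScale klE0 n - klScale klE0 (n + 1) with ha
  set c : ℝ := ((β * (L : ℝ) ^ 2) ^ 3)⁻¹ with hc
  set nS : ℝ := ‖∑ p : FreqMomentum L M, ∑ σ : Fin 2,
        (((((Wd t p) : ℝ) : ℂ) * (((β * (L : ℝ) ^ 2 : ℝ) : ℂ) * propCT L M β μ K p)) * ((((Φ j t p) : ℝ) : ℂ) * (((β * (L : ℝ) ^ 2 : ℝ) : ℂ) * propCT L M β μ K p))) *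
          (V6 j t ![((p, σ), 0), ((p, σ), 1), (((omega0 M, y), 0), 0), ((((omega0 M).rev, Qm - y), 1), 0), ((((omega0 M).rev, Qm - x), 1), 1),
              (((omega0 M, x), 0), 1)] * Sg j t p σ)‖ with hnS
  have hac : 0 ≤ a * c := mul_nonneg ha0 hc0
  -- `a·c·‖S_S‖ ≤ a·Row + ε·2048·15367`
  have hb_le : a * c * nS ≤ a * klmsRowBound B.Dtmin A (4 + 8 / 3 * R.Gfr 1 * U ^ 2) A₀ LA β n j 0 L + ε * (2048 * 15367) := by
    have e : a * c * ((β * (L : ℝ) ^ 2) ^ 2 * (β * (L : ℝ) ^ 2 * klmsRowBound B.Dtmin A (4 + 8 / 3 * R.Gfr 1 * U ^ 2) A₀ LA β n j 0 L)) =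
        a * klmsRowBound B.Dtmin A (4 + 8 / 3 * R.Gfr 1 * U ^ 2) A₀ LA β n j 0 L := by
      rw [hc]; field_simp
    have h1 := mul_le_mul_of_nonneg_left hsig hac
    rw [mul_add, e] at h1
    have h2 : ε * (2048 * klSoftMass L M β μ K n (Φ j t)) ≤ ε * (2048 * 15367) := mul_le_mul_of_nonneg_left (by linarith only [hsm]) hε
    linarith only [h1, hfl, h2]
  rw [hread] at hb_le
  rw [← hTB]
  linarith only [hb_le, harith]

end Model

/-! ## §3 Where the main term goes -/

/-- **The born main term books into the cubic slot of `eremBar … n`**: for `0 ≤ s`, `0 ≤ Q.CR·(Klam|U|)³` and the size `ZS₀·klE0 ≤ 4·s·Q.CR·(Klam|U|)³`,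
`ZS₀·Λₙ₊₁ ≤ s·(Q.CR·(Klam|U|)³·(2ⁿ)⁻¹)` (`Λₙ₊₁ = klE0·4⁻⁽ⁿ⁺¹⁾`, `4⁻ⁿ ≤ 2⁻ⁿ`). -/
theorem born_main_le_CR_slot (P : SplitConsts) (Q : EngConsts) (U : ℝ) {ZS s : ℝ} (hs : 0 ≤ s) (hK3 : 0 ≤ Q.CR * (P.Klam * |U|) ^ 3) (n : ℕ)
    (hfit : ZS * klE0 ≤ 4 * s * (Q.CR * (P.Klam * |U|) ^ 3)) :
    ZS * klScale klE0 (n + 1) ≤ s * (Q.CR * (P.Klam * |U|) ^ 3 * ((2 : ℝ) ^ n)⁻¹) := by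
  have hsc : klScale klE0 (n + 1) = klE0 * ((4 : ℝ) ^ (n + 1))⁻¹ := rfl
  have h4 : (0 : ℝ) < (4 : ℝ) ^ n := by positivity
  have h2 : (0 : ℝ) < (2 : ℝ) ^ n := by positivity
  have h42 : ((4 : ℝ) ^ n)⁻¹ ≤ ((2 : ℝ) ^ n)⁻¹ := inv_anti₀ h2 (pow_le_pow_left₀ (by norm_num) (by norm_num) n)
  calc ZS * klScale klE0 (n + 1) = ZS * klE0 * ((4 : ℝ) ^ n)⁻¹ / 4 := by rw [hsc, pow_succ, mul_inv]; ring
    _ ≤ 4 * s * (Q.CR * (P.Klam * |U|) ^ 3) * ((4 : ℝ) ^ n)⁻¹ / 4 := by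
        have := mul_le_mul_of_nonneg_right hfit (inv_nonneg.mpr h4.le); linarith
    _ = s * (Q.CR * (P.Klam * |U|) ^ 3 * ((4 : ℝ) ^ n)⁻¹) := by ring
    _ ≤ s * (Q.CR * (P.Klam * |U|) ^ 3 * ((2 : ℝ) ^ n)⁻¹) :=
        mul_le_mul_of_nonneg_left (mul_le_mul_of_nonneg_left h42 hK3) hs

/-- **The universal zero-transfer floor of `klEngGeo11.phGain`**: `2²⁸·min 1 (2²⁴·(4ᵐ)⁻¹) ≤ klEngGeo11.phGain m ρ` for every `m` and every `ρ ≥ 0`. -/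
theorem two_pow_28_min_le_klEngGeo11_phGain (m : ℕ) {ρ : ℝ} (hρ : 0 ≤ ρ) :
    (2 : ℝ) ^ 28 * min 1 (2 ^ 24 * ((4 : ℝ) ^ m)⁻¹) ≤ klEngGeo11.phGain m ρ := by
  refine le_trans ?_ (klEngGeo5_phGain_le_klEngGeo11 m ρ)
  have hmin1 : min (1 : ℝ) (2 ^ 24 * ((4 : ℝ) ^ m)⁻¹) ≤ 1 := min_le_left _ _
  by_cases hm : m ≤ 12
  · rw [klg5_phGain_eq_of_le_twelve hm]
    nlinarith [hmin1]
  · push Not at hm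
    rw [klg5_phGain_eq hρ m]
    refine mul_le_mul_of_nonneg_left ?_ (by norm_num)
    have h4 : (0 : ℝ) < (4 : ℝ) ^ m := by positivity
    have h2 : (0 : ℝ) < (2 : ℝ) ^ m := by positivity
    have hE0 : (0 : ℝ) < klE0 := by unfold klE0; norm_num
    have hB : 2 ^ 24 * ((4 : ℝ) ^ m)⁻¹ ≤ 2 ^ 24 * ((4 : ℝ) ^ m)⁻¹ + 2 ^ 24 * ρ / klE0 * (4 : ℝ) ^ m := by
      have : 0 ≤ 2 ^ 24 * ρ / klE0 * (4 : ℝ) ^ m := by positivity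
      linarith
    have hA : min (1 : ℝ) (2 ^ 24 * ((4 : ℝ) ^ m)⁻¹) ≤
        (if 0 < ρ then 2 ^ 24 * (klE0 * ((4 : ℝ) ^ m)⁻¹) / ρ + 2 ^ 24 * Real.sqrt klE0 * ((2 : ℝ) ^ m)⁻¹ else 1) := by
      split_ifs with hρ'
      · refine (min_le_right _ _).trans ?_
        have hsq := one_div_eight_le_sqrt_klE0
        have hfirst : 0 ≤ 2 ^ 24 * (klE0 * ((4 : ℝ) ^ m)⁻¹) / ρ := by positivity
        have h8 : ((4 : ℝ) ^ m)⁻¹ ≤ 1 / 8 * ((2 : ℝ) ^ m)⁻¹ := by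
          have e4 : ((4 : ℝ) ^ m) = (2 : ℝ) ^ m * (2 : ℝ) ^ m := by rw [← mul_pow]; norm_num
          rw [e4, mul_inv]
          have h2m : (8 : ℝ) ≤ (2 : ℝ) ^ m := by
            calc (8 : ℝ) = 2 ^ 3 := by norm_num
              _ ≤ 2 ^ m := pow_le_pow_right₀ (by norm_num) (by omega)
          have : ((2 : ℝ) ^ m)⁻¹ ≤ 1 / 8 := by rw [one_div]; exact inv_anti₀ (by norm_num) h2m
          exact mul_le_mul_of_nonneg_right this (inv_nonneg.mpr h2.le)
        have hsec : 2 ^ 24 * ((4 : ℝ) ^ m)⁻¹ ≤ 2 ^ 24 * Real.sqrt klE0 * ((2 : ℝ) ^ m)⁻¹ := by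
          calc 2 ^ 24 * ((4 : ℝ) ^ m)⁻¹ ≤ 2 ^ 24 * (1 / 8 * ((2 : ℝ) ^ m)⁻¹) := mul_le_mul_of_nonneg_left h8 (by norm_num)
            _ = 2 ^ 24 * (1 / 8) * ((2 : ℝ) ^ m)⁻¹ := by ring
            _ ≤ 2 ^ 24 * Real.sqrt klE0 * ((2 : ℝ) ^ m)⁻¹ :=
                mul_le_mul_of_nonneg_right (mul_le_mul_of_nonneg_left hsq (by norm_num)) (inv_nonneg.mpr h2.le)
        linarith
      · exact min_le_left _ _
    exact le_min (min_le_left _ _) (le_min ((min_le_right _ _).trans hB) hA)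

end Summit.HubbardSuperconductivity.HubbardSuperconductivity.Theorems.KLRegimeSplit

end
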